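import Literature.Probability.RandomPlanarGeometry.SAWBridgeZigzag
import Literature.Probability.RandomPlanarGeometry.SAWBridgeSparseLevels
import HarnessLib

/-!
# DCH 2013 Proposition 3.2, Case 2: the count behind "unfold all zigzags" (lane «DCH-1.1», K1-H2)

Topic `Literature/Probability/RandomPlanarGeometry` (continues `SAWBridgeZigzag.lean` — zigzags `Zd.zigzags`, the unfolding
`Zd.unfoldZigzags`, its involution `unfoldZigzags_unfoldZigzags`, Lemma 3.7 `le_unfoldZigzags_apply_last`, the level
lemma `card_sparse_levels_le_card_sparse_levels_unfoldZigzags_pred` ((3.4)) — and `SAWBridgeSparseLevels.lean` — the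
sets `Zd.sparseHighBridges d n v δ k = SAB^k_{n,v,δ}`).

Source: H. Duminil-Copin, A. Hammond, *Self-avoiding walk is sub-ballistic*, Commun. Math. Phys. 324 (2013), proof of
Proposition 3.2, Case 2 (arXiv:1205.0401v1 pp. 14–15, displays (3.4) and (3.5) as printed there): "`Unf_{Z_γ}(SAB^k_{u_n,v,δ}) ⊆ SAB^{k-1}_{u_n,v,δ}`
… an element in the range has at most `binom(u_n, 2ε_n u_n)` preimages: the preimages of a given `φ` are determined
by the sets of indices of the zig and zag points of their zigzags, which number at most `2ε_n u_n`."

## What is proved (every `d ≥ 1`)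
* (imported from `SAWBridgeZigzag.lean`, section IndexSet: `indexSet`, the pairing lemma `eq_of_indexSet_eq`,
  `unfoldZigzags_filter_lt` (degenerate pairs are inert), `injOn_indexSet_of_unfoldZigzags_eq`,
  `card_powerset_filter_card_le`);
* `unfoldZigzags_all_mem_sparseHighBridges_pred` — (3.4) + Lemma 3.7 in the lane's vocabulary:
  `γ ∈ SAB^k_{n,v,δ} ⇒ Unf_{Z(γ)}(γ) ∈ SAB^{k-1}_{n,v,δ}` (`k ≥ 2`);
* **`card_sparseHighBridges_filter_card_zigzags_le`** (H2): for `k ≥ 2` and every `m`,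
  `#{γ ∈ SAB^k_{n,v,δ} : #Z^{nd}(γ) ≤ m} ≤ (Σ_{s ≤ 2m} C(n+1, s)) · #SAB^{k-1}_{n,v,δ}`, `Z^{nd}` the non-degenerate
  zigzags — by the injection `γ ↦ (Unf_{Z(γ)} γ, indexSet Z^{nd}(γ))` into `SAB^{k-1}_{n,v,δ} × {I ⊆ [0,n] : #I ≤ 2m}`.
Tree-twin search: stems `filter_card_zigzags`, `sparseHighBridges_pred`, `Case2` → none. No twin.
-/

noncomputable section

open Finset Function Literature.Probability.LatticeModels Literature.Probability.Percolation SimpleGraph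
open scoped BigOperators

namespace Literature.Probability.RandomPlanarGeometry.SAW.Zd

variable {d : ℕ} [NeZero d]

/-! ### (3.4) + Lemma 3.7 in the lane's vocabulary -/

/-- `levelVisits` (the lane's K2 file) is the cardinality of `levelSteps` (the zigzag layer): same filter term.
[cite: DuminilCopinHammond2013, §3 (definition of V_{h,h+1}, arXiv v1, p. 11)] -/
theorem levelVisits_eq_card_levelSteps (n : ℕ) (ω : ℕ → Site d) (h : ℤ) :
    levelVisits n ω h = #(levelSteps n ω h) := rfl

/-- `sparseLevelCount m n ω = #{0 ≤ h < y(ω_n) : |V_{h,h+1}(ω)| ≤ m}` with `levelSteps`.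
[cite: DuminilCopinHammond2013, §3 (definition of SAB^m_{n,v,δ}, arXiv v1, p. 11)] -/
theorem sparseLevelCount_eq (m n : ℕ) (ω : ℕ → Site d) :
    sparseLevelCount m n ω = #((range (ω n 0).toNat).filter fun h : ℕ => #(levelSteps n ω (h : ℤ)) ≤ m) := rfl

/-- **(3.4) with Lemma 3.7**: unfolding all zigzags maps `SAB^k_{n,v,δ}` into `SAB^{k-1}_{n,v,δ}` (`k ≥ 2`).
[cite: DuminilCopinHammond2013, proof of Prop. 3.2, Case 2, display (3.4) (arXiv v1, p. 14)] -/
theorem unfoldZigzags_all_mem_sparseHighBridges_pred {n : ℕ} {v δ : ℝ} {k : ℕ} (hk : 2 ≤ k) {γ : ℕ → Site d}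
    (hγ : γ ∈ sparseHighBridges d n v δ k) :
    unfoldZigzags (zigzags n γ) γ ∈ sparseHighBridges d n v δ (k - 1) := by
  unfold sparseHighBridges highBridges at hγ ⊢
  rw [Finset.mem_filter, Finset.mem_filter] at hγ ⊢
  obtain ⟨⟨hγb, hhigh⟩, hsparse⟩ := hγ
  have hZ : zigzags n γ ⊆ zigzags n γ := Subset.refl _
  refine ⟨⟨unfoldZigzags_mem_bridges hγb hZ, hhigh.trans ?_⟩, hsparse.trans ?_⟩
  · exact_mod_cast le_unfoldZigzags_apply_last hZ
  · rw [sparseLevelCount_eq, sparseLevelCount_eq]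
    exact_mod_cast card_sparse_levels_le_card_sparse_levels_unfoldZigzags_pred hγb hk

/-! ### H2: the Case 2 count -/

/-- **H2 — DCH Proposition 3.2, Case 2, as a count** (lane «DCH-1.1» node K1-H2): for `k ≥ 2` and every `m`,
`#{γ ∈ SAB^k_{n,v,δ} : #Z^{nd}(γ) ≤ m} ≤ (Σ_{s ≤ 2m} C(n+1, s)) · #SAB^{k-1}_{n,v,δ}`, where `Z^{nd}(γ)` is the set of
non-degenerate zigzags (`i < j`). The map `γ ↦ (Unf_{Z(γ)}(γ), endpoints of Z^{nd}(γ))` is injective (pairing lemma +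
the involution `unfoldZigzags_unfoldZigzags`; degenerate zigzags are inert), lands in `SAB^{k-1}_{n,v,δ}` by (3.4) and
Lemma 3.7, and the endpoint set is a subset of `[0, n]` of size `≤ 2m`.
[cite: DuminilCopinHammond2013, proof of Prop. 3.2, Case 2, displays (3.3)–(3.5) (arXiv v1, pp. 14–15)] -/
theorem card_sparseHighBridges_filter_card_zigzags_le (n : ℕ) (v δ : ℝ) {k : ℕ} (hk : 2 ≤ k) (m : ℕ) :
    #((sparseHighBridges d n v δ k).filter fun γ => #((zigzags n γ).filter fun z => z.1 < z.2) ≤ m) ≤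
      (∑ s ∈ range (2 * m + 1), (n + 1).choose s) * #(sparseHighBridges d n v δ (k - 1)) := by
  classical
  set T := (sparseHighBridges d n v δ k).filter fun γ => #((zigzags n γ).filter fun z => z.1 < z.2) ≤ m with hT
  set P := ((range (n + 1)).powerset).filter fun I => #I ≤ 2 * m with hP
  have hmain : #T ≤ #(sparseHighBridges d n v δ (k - 1) ×ˢ P) := by
    refine Finset.card_le_card_of_injOn
      (fun γ => (unfoldZigzags (zigzags n γ) γ, indexSet ((zigzags n γ).filter fun z => z.1 < z.2)))
      (fun γ hγ => ?_) (fun γ hγ γ' hγ' h => ?_)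
    · rw [Finset.mem_coe, hT, Finset.mem_filter] at hγ
      obtain ⟨hγS, hγm⟩ := hγ
      rw [Finset.mem_coe, Finset.mem_product]
      refine ⟨unfoldZigzags_all_mem_sparseHighBridges_pred hk hγS, ?_⟩
      rw [hP, Finset.mem_filter, Finset.mem_powerset]
      exact ⟨indexSet_subset_range ((Finset.filter_subset _ _).trans (zigzags_subset_product n γ)),
        (card_indexSet_le _).trans (by omega)⟩
    · simp only [Prod.mk.injEq] at h
      obtain ⟨hU, hI⟩ := h
      exact injOn_indexSet_of_unfoldZigzags_eq n (unfoldZigzags (zigzags n γ') γ') (by exact hU) (by rfl) hI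
  calc #T ≤ #(sparseHighBridges d n v δ (k - 1) ×ˢ P) := hmain
    _ = #(sparseHighBridges d n v δ (k - 1)) * #P := Finset.card_product _ _
    _ = #(sparseHighBridges d n v δ (k - 1)) * ∑ s ∈ range (2 * m + 1), (n + 1).choose s := by
        rw [hP, card_powerset_filter_card_le, Finset.card_range]
    _ = _ := Nat.mul_comm _ _

end Literature.Probability.RandomPlanarGeometry.SAW.Zd

end
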